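/-
Copyright (c) 2026 the pub-hodgecm-mathlib formalisation cell (harness21).  Prover seat hodgecm-mathlib-F0P3a-p09 (g9); dealer LH4-plan (g7) WORD #62 deal (o3)
«the `hσd` letter at the trace literal», 2026-09-02.  Count-neutral LAYER C brick of the dyadic (D-UNR) column; consumer (C5)′ TorusAll (LH5-p04).
-/
import Literature.NumberTheory.Rogawski1990.UnitOrbitalIntegralInertCountJPosTorusTrace   -- ★ p852132 (LH3-p01): `traceCorner_defect_ratio_sub_map` (the identity, by `b + σb = 1`)
import HarnessLib

/-!
# The σ-defect hypothesis `hσd` of ★ (C3c) at the trace literal `M_{b,π₁}(x₁,e,x₃)`: `|σ((A − e)∕B₂) − (D − e)∕B₂| = |x₁ − e|·|x₃ − e|∕|B₂|`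

Topic `NumberTheory/Rogawski1990`; namespace `Literature.NumberTheory.Automorphic.UnitaryGroup`.  THEOREMS ONLY (no definition, no instance, no notation, no named fact,
no `sorry`); kernel lane `--supports stmt-HodgeConjecture-24833`.  Dealer LH4-plan (g7) WORD #62 (o3).  The regime-four head ★ p852095 `natCard_cosets_regime_four_of_rel`
and the dispatcher ★ p852112 `natCard_cosets_eq_iTen_of_rel` carry the σ-defect binder **`hσd : Valued.v (σ ((A − b) ∕ B₂) − (D − b) ∕ B₂) ≤ Valued.v (ϖ ^ k)`** (★
`UnitaryThreeBorelCosetCountQuadratic`'s `|σd − d| ≤ |ϖ^k|` WITHOUT the factor `2`).  At the trace corner `A = x₁σb + x₃b`, `D = x₁b + x₃σb`, `B₂ = π₁′·bσb·(x₁ − x₃)`,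
middle eigenvalue `e` (★ F1's literal; `b + σb = 1`, norm-one `x₁, e, x₃`, `σπ₁′ = π₁′`) ★ p852132 `traceCorner_defect_ratio_sub_map` prints the IDENTITY
`(A − e)∕B₂ − σ((D − e)∕B₂) = (x₁ − e)(e − x₃)∕(e·B₂)`; this file turns it into the LETTER the heads want: the exact valuation
`|σ((A − e)∕B₂) − (D − e)∕B₂| = |x₁ − e|·|x₃ − e|∕|B₂|` (`|e| = 1`) and the bound `≤ |ϖ^k|` from `|x₁ − e| ≤ |ϖ^{N₁}|`, `|x₃ − e| ≤ |ϖ^{N₂}|`, `|B₂| = |ϖ^ν|`,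
`ν + k ≤ N₁ + N₂` — usable in EVERY cell (type A with equalities, type B with bounds), every residue characteristic; ★ p852132 :143–:160 is the inlined type-A instance.
HONEST LABEL: HC_CM is proved only modulo the printed citations (hLiu418 = `stmt-HodgeConjecture-24832`, h413 = `stmt-HodgeConjecture-24833`) until rung 0 closes; (D-UNR)
stays PRINT by D74′; valued-field letter algebra, count-neutral, pays no organ, opens no road.

## References
* [Flicker1998UnitaryFL] Y. Z. Flicker, *Elementary proof of the fundamental lemma for a unitary group*, Canad. J. Math. 50 (1998), 74–98: Prop. 10 p. 86 (the σ-defect of `B∕B″`).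
-/

set_option autoImplicit false

open scoped WithZero Valued

namespace Literature.NumberTheory.Automorphic

namespace UnitaryGroup

open Literature.NumberTheory.Automorphic.HermitianLattice (UnramifiedLocalConjDatum)

variable {K : Type*} [Field K] [Valued K ℤᵐ⁰] {ϖ : K} (σ : K →+* K)

/-- **The σ-defect of the trace corner, as an exact valuation**: `|σ((A − e)∕B₂) − (D − e)∕B₂| = |x₁ − e|·|x₃ − e|∕|B₂|` for the literal `M_{b,π₁}(x₁,e,x₃)`
(`A = x₁σb + x₃b`, `D = x₁b + x₃σb`, `B₂ = π₁′bσb(x₁−x₃)`; `σ` an isometric involution, `b + σb = 1`, `σπ₁′ = π₁′`, norm-one `x₁, e, x₃`, `x₁ ≠ x₃`) — ★ p852132's identity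
conjugated (`σβ₁ − β₂ = σ(β₁ − σβ₂)`) and `|e| = 1`. [cite: Flicker1998UnitaryFL, Prop. 10 p. 86] -/
theorem v_map_traceCornerRatio_sub_eq (hσσ : ∀ a, σ (σ a) = a) (hσv : ∀ a, Valued.v (σ a) = Valued.v a) {b π₁' x₁ e x₃ : K}
    (hb : b + σ b = 1) (hb0 : b ≠ 0) (hσb0 : σ b ≠ 0) (hσπ' : σ π₁' = π₁') (hπ0 : π₁' ≠ 0)
    (hx₁ : σ x₁ * x₁ = 1) (he : σ e * e = 1) (hx₃ : σ x₃ * x₃ = 1) (h13 : x₁ ≠ x₃) :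
    Valued.v (σ ((x₁ * σ b + x₃ * b - e) / (π₁' * (b * σ b * (x₁ - x₃)))) - (x₁ * b + x₃ * σ b - e) / (π₁' * (b * σ b * (x₁ - x₃)))) =
      Valued.v (x₁ - e) * Valued.v (x₃ - e) / Valued.v (π₁' * (b * σ b * (x₁ - x₃))) := by
  have key := traceCorner_defect_ratio_sub_map σ hσσ hb hb0 hσb0 hσπ' hπ0 hx₁ he hx₃ h13
  have hve : Valued.v e = 1 := by
    have h1 := congrArg Valued.v he
    rw [map_mul, hσv, map_one] at h1
    exact Literature.NumberTheory.QuadraticForms.OMeara65.WithZeroMulInt.eq_one_of_mul_self h1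
  have e1 : σ ((x₁ * σ b + x₃ * b - e) / (π₁' * (b * σ b * (x₁ - x₃)))) - (x₁ * b + x₃ * σ b - e) / (π₁' * (b * σ b * (x₁ - x₃))) =
      σ ((x₁ - e) * (e - x₃) / (e * (π₁' * (b * σ b * (x₁ - x₃))))) := by
    rw [← key, map_sub, hσσ]
  rw [e1, hσv, map_div₀, map_mul, map_mul, hve, one_mul, ← Valuation.map_sub_swap _ e x₃]

/-- **The `hσd` letter at the trace literal**: if `|x₁ − e| ≤ |ϖ^{N₁}|`, `|x₃ − e| ≤ |ϖ^{N₂}|`, `|B₂| = |ϖ^ν|` and `ν + k ≤ N₁ + N₂`, then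
`|σ((A − e)∕B₂) − (D − e)∕B₂| ≤ |ϖ^k|` — the σ-defect hypothesis of ★ p852095 `natCard_cosets_regime_four_of_rel` ∕ ★ p852112 `natCard_cosets_eq_iTen_of_rel` discharged
from the eigen-orders, type A or B alike (regime four: `N₁ = N₂ = ν`, `k = 2m − ν`, `m ≤ ν`). [cite: Flicker1998UnitaryFL, Prop. 10 p. 86] -/
theorem v_map_traceCornerRatio_sub_le (hd : UnramifiedLocalConjDatum σ ϖ) {b π₁' x₁ e x₃ : K}
    (hb : b + σ b = 1) (hb0 : b ≠ 0) (hσb0 : σ b ≠ 0) (hσπ' : σ π₁' = π₁') (hπ0 : π₁' ≠ 0)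
    (hx₁ : σ x₁ * x₁ = 1) (he : σ e * e = 1) (hx₃ : σ x₃ * x₃ = 1) (h13 : x₁ ≠ x₃)
    {N₁ N₂ ν k : ℕ} (hN₁ : Valued.v (x₁ - e) ≤ Valued.v (ϖ ^ N₁)) (hN₂ : Valued.v (x₃ - e) ≤ Valued.v (ϖ ^ N₂))
    (hB₂ : Valued.v (π₁' * (b * σ b * (x₁ - x₃))) = Valued.v (ϖ ^ ν)) (hk : ν + k ≤ N₁ + N₂) :
    Valued.v (σ ((x₁ * σ b + x₃ * b - e) / (π₁' * (b * σ b * (x₁ - x₃)))) - (x₁ * b + x₃ * σ b - e) / (π₁' * (b * σ b * (x₁ - x₃)))) ≤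
      Valued.v (ϖ ^ k) := by
  rw [v_map_traceCornerRatio_sub_eq σ hd.σσ hd.vσ hb hb0 hσb0 hσπ' hπ0 hx₁ he hx₃ h13, hB₂]
  have hpos : 0 < Valued.v (ϖ ^ ν) := by rw [hd.v_pow]; exact WithZero.zero_lt_coe _
  rw [div_le_iff₀ hpos, ← map_mul (Valued.v) (ϖ ^ k), ← pow_add]
  calc Valued.v (x₁ - e) * Valued.v (x₃ - e) ≤ Valued.v (ϖ ^ N₁) * Valued.v (ϖ ^ N₂) := mul_le_mul' hN₁ hN₂
    _ = Valued.v (ϖ ^ (N₁ + N₂)) := by rw [← map_mul, ← pow_add]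
    _ ≤ Valued.v (ϖ ^ (k + ν)) := by rw [hd.v_pow, hd.v_pow, WithZero.exp_le_exp]; omega

end UnitaryGroup

end Literature.NumberTheory.Automorphic
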